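import Summits.Langlands.Langlands.Theorems.RationalPeriodQuarterPeriodClassNontrivialOfBLZ
import Literature.NumberTheory.Automorphic.BLZPeriodCocycleInjectivity
import Literature.NumberTheory.Automorphic.BLZPeriodCocycleSingularitiesProofs

/-!
# `PeriodClassNontrivialQuarter` (crux `h₂` of route `Langlands/RationalPeriodQuarter`) — proof

A weight-0 cusp form `u` for `Γ₁(N)` with Laplace eigenvalue `1/4` whose Lewis–Zagier period cocycle is, off finite
sets, the coboundary of a semi-analytic function vanishes identically: the bridge of
`RationalPeriodQuarterPeriodClassNontrivialOfBLZ.lean` (route objects = the `BLZPeriodCocycle` line model at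
`s = 1/2`, base point `i`, `Γ₁(N) ≤ GL₂(ℝ)`) applied to the three Bruggeman–Lewis–Zagier facts, all theorems of the
tree: `BruggemanLewisZagier2015_cocycle_analytic_holds` (`BLZPeriodCocycleAnalyticityProofs`; `r_γ ∈ V_s^ω`, p. 29),
`BruggemanLewisZagier2015_prop_5_1_holds` (`BLZPeriodCocycleInjectivity`; Proposition 5.1, p. 30: injectivity of
`r : E_s^Γ → H¹(Γ; V_s^ω)` for infinite discrete `Γ`) and `BruggemanLewisZagier2015_singularities_invariants_holds`
(`BLZPeriodCocycleSingularitiesProofs`; `S_s^Γ = {0}`, §13.1 p. 83).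

References: [BruggemanLewisZagier2015] R. Bruggeman, J. Lewis, D. Zagier, *Period functions for Maass wave forms and
cohomology*, Mem. AMS 237 no. 1118 (2015), doi:10.1090/memo/1118 — Theorem B p. 6, Prop. 5.1 p. 30, §13.1 p. 83.
-/

noncomputable section

set_option linter.dupNamespace false

namespace Summit.Langlands.Langlands.Theorems

open Literature.NumberTheory.Automorphic

/-- **Crux `PeriodClassNontrivialQuarter` of route `Langlands/RationalPeriodQuarter`** (injectivity of
`Maass¹⁄₄⁰(Γ₁(N)) → H¹(Γ₁(N); V^{ω*})` via the Lewis–Zagier period cocycle).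
[cite: BruggemanLewisZagier2015, Theorem B p. 6, Proposition 5.1 p. 30, §13.1 p. 83] -/
theorem periodClassNontrivialQuarter :
    Summit.Langlands.Langlands.Theses.RationalPeriodQuarter.PeriodClassNontrivialQuarter :=
  periodClassNontrivialQuarter_of_BLZ BruggemanLewisZagier2015_cocycle_analytic_holds
    BruggemanLewisZagier2015_prop_5_1_holds BruggemanLewisZagier2015_singularities_invariants_holds

end Summit.Langlands.Langlands.Theorems
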